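import Literature.Probability.RandomPlanarGeometry.CritPercSLEDimensionUpper
import Literature.Probability.RandomFractals.SecondMomentDimension
import Literature.MeasureTheory.Hausdorff.PlanarRieszEnergy
import HarnessLib

/-!
# The lower bound `P(dim_H γ[0,∞) ≥ 1 + κ/8) > 0` for the SLE trace from the one- and two-point estimates

The named fact `Literature.Probability.RandomPlanarGeometry.ae_dimH_range_sleTrace` (Beffara's
theorem: for `0 < κ ≤ 8`, almost surely `dim_H γ[0, ∞) = 1 + κ/8`; V. Beffara, *The dimension of
the SLE curves*, Ann. Probab. 36 (2008)) is reduced in `CritPercSLEDimension.lean`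
(`ae_dimH_range_sleTrace_of_ae_le_of_pos_of_zero_one'`) to an a.s. upper bound `hU`, a lower
bound with positive probability `hL : P(dim_H γ[0, ∞) ≥ 1 + κ/8) > 0`, the zero-one law (proved
in `CritPercSLEDimensionZeroOne.lean`) and the phase `κ = 8`. Beffara obtains `hL` from his
Proposition 1 (2) (the second moment method, PROVED in abstract form in
`Literature/Probability/RandomFractals/SecondMomentDimension.lean`) fed with the one-point estimate
(Prop. 4 / Cor. 5, "condition 1") and the two-point estimate (§3, (3.5), "condition 3"). This file
**proves that passage** (`measure_le_dimH_range_sleTrace_pos_of_estimates`,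
`measure_dimH_range_sleTrace_ge_pos_of_estimates`): given the two estimates for the events
`{dist(z, γ[0, ∞)) ≤ εₙ}` in a compact window `K ⊆ ℂ` of positive area along a sequence `εₙ ↓ 0`,
`P(dim_H γ[0, ∞) ≥ 2 - s) > 0` (`s = 1 - κ/8`), and assembles Beffara's theorem
(`ae_dimH_range_sleTrace_of_root_facts_of_estimates`, `…_of_local_estimates`, and finally
`ae_dimH_range_sleTrace_of_root_facts_of_onePoint_of_twoPoint`) from the Rohde–Schramm /
Lawler–Schramm–Werner root facts, Beffara's Prop. 4 (two-sided one-point estimate, whose upper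
half gives the a.s. upper bound through `CritPercSLEDimensionUpper.lean`) and the two-point
estimate (3.5) — which are thereby the only remaining non-formalised inputs of the fact.

## The construction

* `Loewner.traceM` — a measurable version of the trace functional (a choice from
  `Loewner.exists_measurable_eq_trace`), `sleSkeleton κ ω` — its values at rational times, and the
  **neighbourhood random sets** `traceNbhd κ K ε = {(ω, z) | z ∈ K, infEDist z (skeleton ω) ≤ ε}`:
  jointly measurable (`measurableSet_traceNbhd`), with closed sections (`isClosed_section_traceNbhd`,
  `infEDist` is continuous) decreasing with `ε`, and on the almost sure event "generated by a curve
  and transient" equal to `{z ∈ K | dist(z, γ[0, ∞)) ≤ ε}` (`mem_traceNbhd_iff_infDist`; the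
  closure of the skeleton is the range, closed by transience, `closure_sleSkeleton_eq`) with
  intersection `K ∩ γ[0, ∞)` along `εₙ → 0` (`iInter_section_traceNbhd_eq`).
* The second moment method is applied with `λ = vol|_K`, `d = 2`
  (`rieszEnergy_volume_restrict_ne_top`, `PlanarRieszEnergy.lean`) and `pₙ = εₙ^s`.

## References

* V. Beffara, *The dimension of the SLE curves*, Ann. Probab. 36 (2008) 1421–1452: §1 p. 1425
  (Prop. 1 and the display "`P(dim_H H = 1 + κ/8) > 0`"), Prop. 4 / Cor. 5, §3 (3.5).
* S. Rohde, O. Schramm, *Basic properties of SLE*, Ann. of Math. 161 (2005): §3 p. 896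
  (measurability of the trace functional), Thm. 7.1 (transience), Cor. 8.2 (upper bound).
-/

noncomputable section

open Set Filter Topology MeasureTheory ProbabilityTheory Metric Complex
open UpperHalfPlane (upperHalfPlaneSet isOpen_upperHalfPlaneSet)
open Literature.MeasureTheory.Hausdorff Literature.Probability.RandomFractals
open scoped NNReal ENNReal

namespace Literature.Probability.RandomPlanarGeometry

/-! ### A measurable version of the trace and its rational skeleton -/

namespace Loewner

/-- **A measurable version of the Loewner trace functional** (a choice from
`exists_measurable_eq_trace`): `traceM U = trace U` for every continuous driving function whose
chain is generated by a curve (`traceM_eq`), and `traceM` is measurable for the product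
σ-algebras (`measurable_traceM`). Rohde–Schramm (2005), §3 p. 896.
[cite: RohdeSchramm2005, §3 p. 896 and Thm 5.1] -/
def traceM : (ℝ≥0 → ℝ) → ℝ≥0 → ℂ :=
  Classical.choose exists_measurable_eq_trace

/-- `traceM` is measurable. [folklore] -/
theorem measurable_traceM : Measurable traceM :=
  (Classical.choose_spec exists_measurable_eq_trace).1

/-- `traceM U = trace U` for continuous `U` generated by a curve. [folklore] -/
theorem traceM_eq {U : ℝ≥0 → ℝ} (hU : Continuous U) (h : ∃ γ, IsGeneratedByCurve U γ) :
    traceM U = trace U :=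
  (Classical.choose_spec exists_measurable_eq_trace).2 U hU h

end Loewner

section Lower

variable (κ : ℝ≥0)

/-- The **rational skeleton** of the (measurable) SLE_κ trace: the countable set of its values at
the times `q⁺`, `q ∈ ℚ`. [folklore] -/
def sleSkeleton (ω : ℝ≥0 → ℝ) : Set ℂ :=
  range fun q : ℚ ↦ Loewner.traceM (sleDriving κ ω) (q : ℝ).toNNReal

/-- The **`ε`-neighbourhood random sets** `C_ε = {(ω, z) | z ∈ K, dist(z, skeleton) ≤ ε}` of the
trace in the window `K` (the random sets to which Beffara's Prop. 1 is applied for `H = γ[0, ∞)`,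
Beffara (2008), §1–§2; here through the rational skeleton of the measurable trace, which makes
them jointly measurable). [folklore] -/
def traceNbhd (K : Set ℂ) (ε : ℝ) : Set ((ℝ≥0 → ℝ) × ℂ) :=
  {p | p.2 ∈ K ∧ infEDist p.2 (sleSkeleton κ p.1) ≤ ENNReal.ofReal ε}

variable {κ}

/-- `infEDist z (skeleton ω) = ⨅_q edist z (traceM (W ω) q⁺)`. [folklore] -/
theorem infEDist_sleSkeleton (z : ℂ) (ω : ℝ≥0 → ℝ) :
    infEDist z (sleSkeleton κ ω) =
      ⨅ q : ℚ, edist z (Loewner.traceM (sleDriving κ ω) (q : ℝ).toNNReal) := by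
  simp only [sleSkeleton, Metric.infEDist, iInf_range]

/-- `(ω, z) ↦ infEDist z (skeleton ω)` is jointly measurable. [folklore] -/
theorem measurable_infEDist_sleSkeleton :
    Measurable fun p : (ℝ≥0 → ℝ) × ℂ ↦ infEDist p.2 (sleSkeleton κ p.1) := by
  simp_rw [infEDist_sleSkeleton]
  refine Measurable.iInf fun q ↦ ?_
  exact measurable_snd.edist ((measurable_pi_apply _).comp
    (Loewner.measurable_traceM.comp ((measurable_sleDriving_pi κ).comp measurable_fst)))

/-- The neighbourhood random sets are jointly measurable (for a closed window). [folklore] -/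
theorem measurableSet_traceNbhd {K : Set ℂ} (hK : IsClosed K) (ε : ℝ) :
    MeasurableSet (traceNbhd κ K ε) :=
  (hK.measurableSet.preimage measurable_snd).inter
    (measurableSet_le measurable_infEDist_sleSkeleton measurable_const)

/-- The sections of the neighbourhood sets are closed. [folklore] -/
theorem isClosed_section_traceNbhd {K : Set ℂ} (hK : IsClosed K) (ε : ℝ) (ω : ℝ≥0 → ℝ) :
    IsClosed (Prod.mk ω ⁻¹' traceNbhd κ K ε) := by
  have : Prod.mk ω ⁻¹' traceNbhd κ K ε =
      K ∩ (fun z ↦ infEDist z (sleSkeleton κ ω)) ⁻¹' Iic (ENNReal.ofReal ε) := by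
    ext z
    simp [traceNbhd]
  rw [this]
  exact hK.inter (isClosed_Iic.preimage Metric.continuous_infEDist)

/-- The sections decrease as `ε` decreases. [folklore] -/
theorem section_traceNbhd_mono {K : Set ℂ} {ε ε' : ℝ} (h : ε ≤ ε') (ω : ℝ≥0 → ℝ) :
    Prod.mk ω ⁻¹' traceNbhd κ K ε ⊆ Prod.mk ω ⁻¹' traceNbhd κ K ε' := fun _ hz ↦
  ⟨hz.1, hz.2.trans (ENNReal.ofReal_le_ofReal h)⟩

/-- On the event that the chain of `√κ B(ω)` is generated by a curve and the trace is transient,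
the closure of the rational skeleton is the range of the trace. [folklore] -/
theorem closure_sleSkeleton_eq {ω : ℝ≥0 → ℝ}
    (hgen : ∃ γ, Loewner.IsGeneratedByCurve (sleDriving κ ω) γ)
    (htr : Tendsto (fun t ↦ ‖sleTrace κ ω t‖) atTop atTop) :
    closure (sleSkeleton κ ω) = range (sleTrace κ ω) := by
  have hT : Loewner.traceM (sleDriving κ ω) = sleTrace κ ω :=
    Loewner.traceM_eq (continuous_sleDriving κ ω) hgen
  have hcont : Continuous (sleTrace κ ω) := continuous_sleTrace κ ω
  have hS : sleSkeleton κ ω = sleTrace κ ω '' range (fun q : ℚ ↦ (q : ℝ).toNNReal) := by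
    rw [sleSkeleton, hT, ← range_comp]
    rfl
  have hsurj : Function.Surjective Real.toNNReal := fun x ↦ ⟨x, Real.toNNReal_coe⟩
  have hdense : DenseRange (fun q : ℚ ↦ (q : ℝ).toNNReal) :=
    hsurj.denseRange.comp Rat.denseRange_cast continuous_real_toNNReal
  apply subset_antisymm
  · rw [hS]
    exact closure_minimal (image_subset_range _ _)
      (Loewner.isClosed_range_of_tendsto_norm_atTop hcont htr)
  · rw [hS]
    exact hcont.range_subset_closure_image_dense hdense

/-- On the same event, for `εₙ → 0`, the intersection of the sections of the
neighbourhood sets is `K ∩ γ[0, ∞)`. [folklore] -/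
theorem iInter_section_traceNbhd_eq {ω : ℝ≥0 → ℝ}
    (hgen : ∃ γ, Loewner.IsGeneratedByCurve (sleDriving κ ω) γ)
    (htr : Tendsto (fun t ↦ ‖sleTrace κ ω t‖) atTop atTop) (K : Set ℂ)
    {ε : ℕ → ℝ} (hεlim : Tendsto ε atTop (𝓝 0)) :
    (⋂ n, Prod.mk ω ⁻¹' traceNbhd κ K (ε n)) = K ∩ range (sleTrace κ ω) := by
  rw [← closure_sleSkeleton_eq hgen htr]
  ext z
  simp only [mem_iInter, mem_preimage, traceNbhd, mem_setOf_eq, mem_inter_iff,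
    Metric.mem_closure_iff_infEDist_zero]
  constructor
  · intro h
    refine ⟨(h 0).1, le_antisymm ?_ zero_le⟩
    have ht : Tendsto (fun n ↦ ENNReal.ofReal (ε n)) atTop (𝓝 0) := by
      simpa using ENNReal.tendsto_ofReal hεlim
    exact ge_of_tendsto' ht fun n ↦ (h n).2
  · rintro ⟨hzK, h0⟩ n
    exact ⟨hzK, h0.le.trans zero_le⟩

/-- `infEDist z (range γ) ≤ ofReal ε ↔ infDist z (range γ) ≤ ε` (`ε ≥ 0`; the range is
nonempty). [folklore] -/
theorem infEDist_range_le_ofReal_iff (γ : ℝ≥0 → ℂ) (z : ℂ) {ε : ℝ} (hε : 0 ≤ ε) :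
    infEDist z (range γ) ≤ ENNReal.ofReal ε ↔ infDist z (range γ) ≤ ε := by
  rw [infDist, ENNReal.le_ofReal_iff_toReal_le (Metric.infEDist_ne_top (range_nonempty γ)) hε]

/-- On the good event, membership of `(ω, z)` in the neighbourhood set is `dist(z, γ[0,∞)) ≤ ε`
(for `z ∈ K`, `ε ≥ 0`). [folklore] -/
theorem mem_traceNbhd_iff_infDist {ω : ℝ≥0 → ℝ}
    (hgen : ∃ γ, Loewner.IsGeneratedByCurve (sleDriving κ ω) γ)
    (htr : Tendsto (fun t ↦ ‖sleTrace κ ω t‖) atTop atTop) {K : Set ℂ} {z : ℂ} (hz : z ∈ K)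
    {ε : ℝ} (hε : 0 ≤ ε) :
    (ω, z) ∈ traceNbhd κ K ε ↔ infDist z (range (sleTrace κ ω)) ≤ ε := by
  simp only [traceNbhd, mem_setOf_eq, hz, true_and]
  rw [← Metric.infEDist_closure, closure_sleSkeleton_eq hgen htr, infEDist_range_le_ofReal_iff _ _ hε]


/-! ### The lower bound with positive probability -/

/-- **`P(dim_H γ[0, ∞) ≥ 2 - s) > 0` from the one- and two-point estimates** (the lower-bound half
of Beffara's display "this implies that `P(dim_H H = 1 + κ/8) > 0`", Beffara (2008), §1 p. 1425,
i.e. the passage Prop. 1 (2) + conditions 1, 3 ⇒ positive probability, made formal). Let SLE_κ be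
generated by a curve with a.s. transient trace, let `K ⊆ ℂ` be a compact window of positive area,
`εₙ ↓` with `εₙ → 0`, `0 ≤ s < 2`, and assume, for `z, x, y ∈ K` and all `n`:

* (condition 1, lower half — Beffara Prop. 4 / Cor. 5) `P(dist(z, γ[0,∞)) ≤ εₙ) ≥ c₁ εₙ^s`;
* (condition 3 — Beffara §3, (3.5) and §3.2) `P(dist(x, γ[0,∞)) ≤ εₙ, dist(y, γ[0,∞)) ≤ εₙ) ≤
  c₃ εₙ^{2s} |x - y|^{-s}`.

Then `P(dim_H γ[0, ∞) ≥ 2 - s) > 0`. Proof: the random sets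
`Cₙ = {(ω, z) | z ∈ K, dist(z, skeleton) ≤ εₙ}` (`traceNbhd`, jointly measurable through the
measurable trace functional `Loewner.traceM`) have closed decreasing sections with
`⋂ₙ Cₙ(ω) = K ∩ γ[0, ∞)` a.s. (the range is closed by transience), satisfy the hypotheses of the
second moment method `exists_measurableSet_le_dimH_iInter` with `λ = vol|_K`, `d = 2`
(`rieszEnergy_volume_restrict_ne_top`) and `pₙ = εₙ^s`, whence `dim_H (K ∩ γ[0,∞)) ≥ 2 - s` on an
event of positive probability. [cite: Beffara2008, §1 p. 1425 (Prop. 1 (2) with conditions 1 and 3)] -/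
theorem measure_le_dimH_range_sleTrace_pos_of_estimates {κ : ℝ≥0} (hκ : HasSLETrace κ)
    (htr : ∀ᵐ ω ∂Process.preWienerMeasure, Tendsto (fun t ↦ ‖sleTrace κ ω t‖) atTop atTop)
    {K : Set ℂ} (hK : IsCompact K) (hKvol : volume K ≠ 0)
    {s : ℝ} (hs0 : 0 ≤ s) (hs2 : s < 2)
    {ε : ℕ → ℝ} (hε0 : ∀ n, 0 < ε n) (hεanti : Antitone ε) (hεlim : Tendsto ε atTop (𝓝 0))
    {c₁ c₃ : ℝ≥0∞} (hc₁ : c₁ ≠ 0) (hc₃ : c₃ ≠ ⊤)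
    (h1 : ∀ n, ∀ z ∈ K, c₁ * ENNReal.ofReal (ε n ^ s) ≤
      Process.preWienerMeasure {ω | infDist z (range (sleTrace κ ω)) ≤ ε n})
    (h3 : ∀ n, ∀ x ∈ K, ∀ y ∈ K,
      Process.preWienerMeasure {ω | infDist x (range (sleTrace κ ω)) ≤ ε n ∧
          infDist y (range (sleTrace κ ω)) ≤ ε n} ≤
        c₃ * ENNReal.ofReal (ε n ^ s) ^ 2 * rieszKernel s x y) :
    0 < Process.preWienerMeasure
      {ω | ENNReal.ofReal (2 - s) ≤ dimH (range (sleTrace κ ω))} := by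
  haveI := isProbabilityMeasure_preWienerMeasure'
  -- the good event
  have hgood : ∀ᵐ ω ∂Process.preWienerMeasure,
      (∃ γ, Loewner.IsGeneratedByCurve (sleDriving κ ω) γ) ∧
        Tendsto (fun t ↦ ‖sleTrace κ ω t‖) atTop atTop := hκ.and htr
  -- the random sets
  set C : ℕ → Set ((ℝ≥0 → ℝ) × ℂ) := fun n ↦ traceNbhd κ K (ε n) with hC
  have hCm : ∀ n, MeasurableSet (C n) := fun n ↦ measurableSet_traceNbhd hK.isClosed _
  have hreg : ∀ᵐ ω ∂Process.preWienerMeasure,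
      (∀ n, IsClosed (Prod.mk ω ⁻¹' C n) ∧ Prod.mk ω ⁻¹' C n ⊆ K) ∧
        Antitone fun n ↦ Prod.mk ω ⁻¹' C n :=
    Eventually.of_forall fun ω ↦
      ⟨fun n ↦ ⟨isClosed_section_traceNbhd hK.isClosed _ ω, fun z hz ↦ hz.1⟩,
        fun m n hmn ↦ section_traceNbhd_mono (hεanti hmn) ω⟩
  -- the reference measure `vol|_K`
  set lam : Measure ℂ := volume.restrict K with hlam_def
  haveI : IsFiniteMeasure lam := by
    rw [hlam_def, isFiniteMeasure_restrict]
    exact hK.measure_lt_top.ne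
  have hlam : lam ≠ 0 := by
    intro h
    apply hKvol
    have h' : lam K = 0 := by rw [h, Measure.coe_zero, Pi.zero_apply]
    rwa [hlam_def, Measure.restrict_apply_self] at h'
  have hlamK : lam Kᶜ = 0 := by
    rw [hlam_def, Measure.restrict_apply hK.isClosed.measurableSet.compl, compl_inter_self,
      measure_empty]
  have hfin : ∀ β : ℝ, 0 < β → β < 2 → rieszEnergy β lam ≠ ⊤ := fun β hβ0 hβ2 ↦
    rieszEnergy_volume_restrict_ne_top hK.isBounded hK.isClosed.measurableSet hβ0.le hβ2
  -- the scales `pₙ = εₙ^s`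
  set p : ℕ → ℝ≥0∞ := fun n ↦ ENNReal.ofReal (ε n ^ s) with hp
  have hp0 : ∀ n, p n ≠ 0 := fun n ↦
    (ENNReal.ofReal_pos.2 (Real.rpow_pos_of_pos (hε0 n) s)).ne'
  have hpt : ∀ n, p n ≠ ⊤ := fun n ↦ ENNReal.ofReal_ne_top
  -- the conditions, transferred to the random sets
  have h1' : ∀ n, ∀ z ∈ K, c₁ * p n ≤ Process.preWienerMeasure {ω | (ω, z) ∈ C n} := by
    intro n z hz
    refine (h1 n z hz).trans (le_of_eq (measure_congr ?_))
    filter_upwards [hgood] with ω hω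
    obtain ⟨hgen, ht⟩ := hω
    show (infDist z (range (sleTrace κ ω)) ≤ ε n) = ((ω, z) ∈ C n)
    exact propext (mem_traceNbhd_iff_infDist hgen ht hz (hε0 n).le).symm
  have h3' : ∀ n, ∀ x ∈ K, ∀ y ∈ K,
      Process.preWienerMeasure (pairSet (C n) x y) ≤ c₃ * p n ^ 2 * rieszKernel s x y := by
    intro n x hx y hy
    refine (le_of_eq (measure_congr ?_)).trans (h3 n x hx y hy)
    filter_upwards [hgood] with ω hω
    obtain ⟨hgen, ht⟩ := hω
    show (ω ∈ pairSet (C n) x y) =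
      (ω ∈ {ω | infDist x (range (sleTrace κ ω)) ≤ ε n ∧ infDist y (range (sleTrace κ ω)) ≤ ε n})
    simp only [pairSet, mem_setOf_eq]
    rw [mem_traceNbhd_iff_infDist hgen ht hx (hε0 n).le,
      mem_traceNbhd_iff_infDist hgen ht hy (hε0 n).le]
  -- the second moment method with `d = 2`
  obtain ⟨E, -, hEpos, hdim⟩ := exists_measurableSet_le_dimH_iInter
    (P := Process.preWienerMeasure) hK hlam hlamK hCm hreg hs0 hs2 hfin hp0 hpt hc₁ hc₃ h1' h3'
  -- conclusion on `E ∩ good`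
  have hgood0 : Process.preWienerMeasure
      {ω | (∃ γ, Loewner.IsGeneratedByCurve (sleDriving κ ω) γ) ∧
        Tendsto (fun t ↦ ‖sleTrace κ ω t‖) atTop atTop}ᶜ = 0 := by
    rw [ae_iff] at hgood
    simpa only [compl_setOf] using hgood
  calc (0 : ℝ≥0∞) < Process.preWienerMeasure E := hEpos
    _ = Process.preWienerMeasure (E ∩ {ω | (∃ γ, Loewner.IsGeneratedByCurve (sleDriving κ ω) γ) ∧
          Tendsto (fun t ↦ ‖sleTrace κ ω t‖) atTop atTop}) := (measure_inter_conull hgood0).symm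
    _ ≤ Process.preWienerMeasure {ω | ENNReal.ofReal (2 - s) ≤ dimH (range (sleTrace κ ω))} := by
        refine measure_mono fun ω ⟨hωE, hgen, ht⟩ ↦ (hdim ω hωE).trans (dimH_mono ?_)
        rw [iInter_section_traceNbhd_eq hgen ht K hεlim]
        exact inter_subset_right

/-- **The lower bound in the normalisation of the fact**: with `s = 1 - κ/8` (`κ < 8`) the
conclusion reads `P(dim_H γ[0, ∞) ≥ 1 + κ/8) > 0`, which is the hypothesis `hL` of
`ae_dimH_range_sleTrace_of_ae_le_of_pos_of_zero_one'` (`CritPercSLEDimension.lean`).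
[cite: Beffara2008, §1 p. 1425 (Prop. 1 (2) with conditions 1 and 3)] -/
theorem measure_dimH_range_sleTrace_ge_pos_of_estimates {κ : ℝ≥0} (hκ : HasSLETrace κ)
    (hκ8 : κ < 8)
    (htr : ∀ᵐ ω ∂Process.preWienerMeasure, Tendsto (fun t ↦ ‖sleTrace κ ω t‖) atTop atTop)
    {K : Set ℂ} (hK : IsCompact K) (hKvol : volume K ≠ 0)
    {ε : ℕ → ℝ} (hε0 : ∀ n, 0 < ε n) (hεanti : Antitone ε) (hεlim : Tendsto ε atTop (𝓝 0))
    {c₁ c₃ : ℝ≥0∞} (hc₁ : c₁ ≠ 0) (hc₃ : c₃ ≠ ⊤)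
    (h1 : ∀ n, ∀ z ∈ K, c₁ * ENNReal.ofReal (ε n ^ (1 - (κ : ℝ) / 8)) ≤
      Process.preWienerMeasure {ω | infDist z (range (sleTrace κ ω)) ≤ ε n})
    (h3 : ∀ n, ∀ x ∈ K, ∀ y ∈ K,
      Process.preWienerMeasure {ω | infDist x (range (sleTrace κ ω)) ≤ ε n ∧
          infDist y (range (sleTrace κ ω)) ≤ ε n} ≤
        c₃ * ENNReal.ofReal (ε n ^ (1 - (κ : ℝ) / 8)) ^ 2 * rieszKernel (1 - (κ : ℝ) / 8) x y) :
    0 < Process.preWienerMeasure {ω | 1 + (κ : ℝ≥0∞) / 8 ≤ dimH (range (sleTrace κ ω))} := by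
  have hκ8' : (κ : ℝ) < 8 := by exact_mod_cast hκ8
  have hκ0' : (0 : ℝ) ≤ κ := κ.2
  have hs0 : 0 ≤ 1 - (κ : ℝ) / 8 := by linarith
  have hs2 : 1 - (κ : ℝ) / 8 < 2 := by linarith
  have h := measure_le_dimH_range_sleTrace_pos_of_estimates hκ htr hK hKvol hs0 hs2 hε0 hεanti
    hεlim hc₁ hc₃ h1 h3
  have hconv : ENNReal.ofReal (2 - (1 - (κ : ℝ) / 8)) = 1 + (κ : ℝ≥0∞) / 8 := by
    rw [show (2 : ℝ) - (1 - (κ : ℝ) / 8) = 1 + (κ : ℝ) / 8 by ring,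
      ENNReal.ofReal_add zero_le_one (by positivity), ENNReal.ofReal_one,
      ENNReal.ofReal_div_of_pos (by norm_num), ENNReal.ofReal_coe_nnreal, ENNReal.ofReal_ofNat]
  rwa [hconv] at h

/-! ### Beffara's theorem from the root facts, the upper bound, and the estimates -/

/-- **`ae_dimH_range_sleTrace` from the Rohde–Schramm / Lawler–Schramm–Werner root facts, the
a.s. upper bound, and the one- and two-point estimates.** The named fact (Beffara's theorem for
`0 < κ ≤ 8`) follows from

* the root facts `hasSLETrace_eight` (LSW (2004), Thm 4.7), `hasSLETrace_of_ne_eight` (RS (2005),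
  Thm 5.1), `tendsto_norm_sleTrace_atTop` (RS Thm 7.1), `ae_infDist_sleTrace_eq_zero_of_eight_le`
  (RS Lemma 6.3 / (6.2)) — used for Lemma 3, transience, and the phase `κ = 8`;
* `hU` — the a.s. upper bound `dim_H γ[0, ∞) ≤ 1 + κ/8` for `0 < κ < 8` (Rohde–Schramm (2005),
  Cor. 8.2; or Beffara's Prop. 1 (1) with the upper half of condition 1 and condition 2);
* `hest` — for every `0 < κ < 8`, the lower one-point and the two-point estimates (Beffara (2008),
  Prop. 4 / Cor. 5 and §3 (3.5)) in some compact window of positive area along some sequence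
  `εₙ ↓ 0`, in the form consumed by `measure_dimH_range_sleTrace_ge_pos_of_estimates`.

Everything else of Beffara's proof — the zero-one law (Lemma 3), the second moment method
(Prop. 1 (2)), the energy / content estimates, the finiteness of planar Riesz energies, the
measurability and the glue — is proved in this library.
[cite: Beffara2008, Theorem (Introduction), §1 p. 1425, Lemma 3 and Prop. 1] -/
theorem ae_dimH_range_sleTrace_of_root_facts_of_estimates (h8 : hasSLETrace_eight)
    (hne : hasSLETrace_of_ne_eight) (htr : tendsto_norm_sleTrace_atTop)
    (hd : ae_infDist_sleTrace_eq_zero_of_eight_le)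
    (hU : ∀ {κ : ℝ≥0}, 0 < κ → κ < 8 →
      ∀ᵐ ω ∂Process.preWienerMeasure, dimH (range (sleTrace κ ω)) ≤ 1 + (κ : ℝ≥0∞) / 8)
    (hest : ∀ {κ : ℝ≥0}, 0 < κ → κ < 8 →
      ∃ (K : Set ℂ) (ε : ℕ → ℝ) (c₁ c₃ : ℝ≥0∞), IsCompact K ∧ volume K ≠ 0 ∧ (∀ n, 0 < ε n) ∧
        Antitone ε ∧ Tendsto ε atTop (𝓝 0) ∧ c₁ ≠ 0 ∧ c₃ ≠ ⊤ ∧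
        (∀ n, ∀ z ∈ K, c₁ * ENNReal.ofReal (ε n ^ (1 - (κ : ℝ) / 8)) ≤
          Process.preWienerMeasure {ω | infDist z (range (sleTrace κ ω)) ≤ ε n}) ∧
        (∀ n, ∀ x ∈ K, ∀ y ∈ K,
          Process.preWienerMeasure {ω | infDist x (range (sleTrace κ ω)) ≤ ε n ∧
              infDist y (range (sleTrace κ ω)) ≤ ε n} ≤
            c₃ * ENNReal.ofReal (ε n ^ (1 - (κ : ℝ) / 8)) ^ 2 * rieszKernel (1 - (κ : ℝ) / 8) x y))
    {κ : ℝ≥0} : ae_dimH_range_sleTrace (κ := κ) := by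
  refine ae_dimH_range_sleTrace_of_ae_le_of_pos_of_zero_one' hU (fun {κ} hκ0 hκ8 ↦ ?_)
    (fun {κ} _ d _ ↦ ae_dimH_range_sleTrace_eq_or_ae_ne (hasSLETrace h8 hne κ) d) h8 hne htr hd
  obtain ⟨K, ε, c₁, c₃, hK, hKv, hε0, hεa, hεl, hc₁, hc₃, h1, h3⟩ := hest hκ0 hκ8
  exact measure_dimH_range_sleTrace_ge_pos_of_estimates (hne hκ8.ne) hκ8 (htr hκ0) hK hKv hε0 hεa
    hεl hc₁ hc₃ h1 h3


/-! ### The same from the estimates in their printed (local, `ε ≤ ε₀`) form -/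

/-- The window used to localise the estimates: the closed unit disc centred at `2i` — compact,
contained in `ℍ`, of positive area. [folklore] -/
theorem window_props :
    IsCompact (closedBall (2 * I) 1) ∧ closedBall (2 * I) 1 ⊆ upperHalfPlaneSet ∧
      volume (closedBall (2 * I : ℂ) 1) ≠ 0 := by
  refine ⟨isCompact_closedBall _ _, fun z hz ↦ ?_, (measure_closedBall_pos volume _ one_pos).ne'⟩
  rw [mem_closedBall, dist_eq_norm] at hz
  have him : |(z - 2 * I).im| ≤ 1 := (abs_im_le_norm _).trans hz
  have h2 : (z - 2 * I).im = z.im - 2 := by simp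
  rw [h2, abs_le] at him
  show 0 < z.im
  linarith [him.1]

/-- **`ae_dimH_range_sleTrace` from the root facts, the upper bound, and the one- and two-point
estimates in their printed local form** (for every compact `K ⊆ ℍ` there are constants and an
`ε₀ > 0` such that the bounds hold for all `0 < ε ≤ ε₀`):

* `hB` — Beffara (2008), Prop. 4 (lower half) / Cor. 5: `P(dist(z, γ[0,∞)) ≤ ε) ≥ c₁ ε^{1-κ/8}`,
  `z ∈ K`;
* `hC` — Beffara (2008), §3, (3.5) and §3.2 ("condition 3"); independently Lawler–Werness (2013),
  Thm 2: `P(dist(x, γ) ≤ ε, dist(y, γ) ≤ ε) ≤ c₃ ε^{2(1-κ/8)} |x - y|^{-(1-κ/8)}`, `x, y ∈ K`.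

The window `K = B̄(2i, 1)` and the scales `εₙ = ε₀/(n+1)` feed
`ae_dimH_range_sleTrace_of_root_facts_of_estimates`.
[cite: Beffara2008, Theorem (Introduction), §1 p. 1425, Prop. 4, (3.5)] -/
theorem ae_dimH_range_sleTrace_of_root_facts_of_local_estimates (h8 : hasSLETrace_eight)
    (hne : hasSLETrace_of_ne_eight) (htr : tendsto_norm_sleTrace_atTop)
    (hd : ae_infDist_sleTrace_eq_zero_of_eight_le)
    (hU : ∀ {κ : ℝ≥0}, 0 < κ → κ < 8 →
      ∀ᵐ ω ∂Process.preWienerMeasure, dimH (range (sleTrace κ ω)) ≤ 1 + (κ : ℝ≥0∞) / 8)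
    (hB : ∀ {κ : ℝ≥0}, 0 < κ → κ < 8 → ∀ K : Set ℂ, IsCompact K → K ⊆ upperHalfPlaneSet →
      ∃ c₁ : ℝ≥0∞, c₁ ≠ 0 ∧ ∃ ε₀ : ℝ, 0 < ε₀ ∧ ∀ ε : ℝ, 0 < ε → ε ≤ ε₀ → ∀ z ∈ K,
        c₁ * ENNReal.ofReal (ε ^ (1 - (κ : ℝ) / 8)) ≤
          Process.preWienerMeasure {ω | infDist z (range (sleTrace κ ω)) ≤ ε})
    (hC : ∀ {κ : ℝ≥0}, 0 < κ → κ < 8 → ∀ K : Set ℂ, IsCompact K → K ⊆ upperHalfPlaneSet →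
      ∃ c₃ : ℝ≥0∞, c₃ ≠ ⊤ ∧ ∃ ε₀ : ℝ, 0 < ε₀ ∧ ∀ ε : ℝ, 0 < ε → ε ≤ ε₀ → ∀ x ∈ K, ∀ y ∈ K,
        Process.preWienerMeasure {ω | infDist x (range (sleTrace κ ω)) ≤ ε ∧
            infDist y (range (sleTrace κ ω)) ≤ ε} ≤
          c₃ * ENNReal.ofReal (ε ^ (1 - (κ : ℝ) / 8)) ^ 2 * rieszKernel (1 - (κ : ℝ) / 8) x y)
    {κ : ℝ≥0} : ae_dimH_range_sleTrace (κ := κ) := by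
  refine ae_dimH_range_sleTrace_of_root_facts_of_estimates h8 hne htr hd hU fun {κ} hκ0 hκ8 ↦ ?_
  obtain ⟨hKc, hKH, hKv⟩ := window_props
  obtain ⟨c₁, hc₁, ε₁, hε₁, h1⟩ := hB hκ0 hκ8 _ hKc hKH
  obtain ⟨c₃, hc₃, ε₃, hε₃, h3⟩ := hC hκ0 hκ8 _ hKc hKH
  set ε₀ : ℝ := min ε₁ ε₃ with hε₀
  have hε₀pos : 0 < ε₀ := lt_min hε₁ hε₃
  set ε : ℕ → ℝ := fun n ↦ ε₀ / ((n : ℝ) + 1) with hε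
  have hεpos : ∀ n, 0 < ε n := fun n ↦ by rw [hε]; positivity
  have hεle : ∀ n, ε n ≤ ε₀ := fun n ↦ by
    rw [hε]
    exact div_le_self hε₀pos.le (by linarith [(Nat.cast_nonneg n : (0 : ℝ) ≤ n)])
  have hεanti : Antitone ε := fun m n hmn ↦ by
    simp only [hε]
    exact div_le_div_of_nonneg_left hε₀pos.le (by positivity) (by exact_mod_cast Nat.add_le_add_right hmn 1)
  have hεlim : Tendsto ε atTop (𝓝 0) := by
    have h := (tendsto_one_div_add_atTop_nhds_zero_nat (𝕜 := ℝ)).const_mul ε₀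
    rw [mul_zero] at h
    refine h.congr fun n ↦ ?_
    simp only [hε]
    ring
  refine ⟨closedBall (2 * I) 1, ε, c₁, c₃, hKc, hKv, hεpos, hεanti, hεlim, hc₁, hc₃,
    fun n z hz ↦ h1 (ε n) (hεpos n) ((hεle n).trans (min_le_left _ _)) z hz,
    fun n x hx y hy ↦ h3 (ε n) (hεpos n) ((hεle n).trans (min_le_right _ _)) x hx y hy⟩


/-! ### Beffara's theorem from the root facts, Prop. 4 and the two-point estimate -/

/-- **`ae_dimH_range_sleTrace` from the Rohde–Schramm / Lawler–Schramm–Werner root facts and the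
two SLE estimates of Beffara's proof, in their printed local form**:

* `hP4` — Beffara (2008), **Prop. 4** (with Cor. 5), the one-point estimate, two-sided: for every
  compact `K ⊆ ℍ` there are `c₁ > 0`, `c₂ < ∞`, `ε₀ > 0` with
  `c₁ ε^{1-κ/8} ≤ P(dist(z, γ[0,∞)) ≤ ε) ≤ c₂ ε^{1-κ/8}` for `z ∈ K`, `0 < ε ≤ ε₀` (printed:
  `P(B(z₀, ε) ∩ H ≠ ∅) ≍ (ε / Im z₀)^{1-κ/8} (sin arg z₀)^{8/κ-1}`, `κ ∈ (0, 8)`, the constants being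
  continuous in `z₀`);
* `hC` — Beffara (2008), **§3, (3.5)** with §3.2 ("condition 3"); independently Lawler–Werness,
  Ann. Probab. 41 (2013), Thm. 2: `P(dist(x, γ) ≤ ε, dist(y, γ) ≤ ε) ≤ c₃ ε^{2(1-κ/8)} |x-y|^{-(1-κ/8)}`.

The upper half of `hP4` gives the a.s. upper bound (`ae_dimH_range_sleTrace_le_of_onePoint_upper'`,
`CritPercSLEDimensionUpper.lean`, Rohde–Schramm's Cor. 8.2), the lower half and `hC` the lower
bound with positive probability (this file), the root facts give the zero-one law (Lemma 3,
`CritPercSLEDimensionZeroOne.lean`), transience and the phase `κ = 8`. These two estimates are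
thereby the only inputs of Beffara's theorem not formalised in this library besides the root facts.
[cite: Beffara2008, Theorem (Introduction), Prop. 1, Lemma 3, Prop. 4 and (3.5)] -/
theorem ae_dimH_range_sleTrace_of_root_facts_of_onePoint_of_twoPoint (h8 : hasSLETrace_eight)
    (hne : hasSLETrace_of_ne_eight) (htr : tendsto_norm_sleTrace_atTop)
    (hd : ae_infDist_sleTrace_eq_zero_of_eight_le)
    (hP4 : ∀ {κ : ℝ≥0}, 0 < κ → κ < 8 → ∀ K : Set ℂ, IsCompact K → K ⊆ upperHalfPlaneSet →
      ∃ c₁ c₂ : ℝ≥0∞, c₁ ≠ 0 ∧ c₂ ≠ ⊤ ∧ ∃ ε₀ : ℝ, 0 < ε₀ ∧ ∀ ε : ℝ, 0 < ε → ε ≤ ε₀ → ∀ z ∈ K,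
        c₁ * ENNReal.ofReal (ε ^ (1 - (κ : ℝ) / 8)) ≤
            Process.preWienerMeasure {ω | infDist z (range (sleTrace κ ω)) ≤ ε} ∧
          Process.preWienerMeasure {ω | infDist z (range (sleTrace κ ω)) ≤ ε} ≤
            c₂ * ENNReal.ofReal (ε ^ (1 - (κ : ℝ) / 8)))
    (hC : ∀ {κ : ℝ≥0}, 0 < κ → κ < 8 → ∀ K : Set ℂ, IsCompact K → K ⊆ upperHalfPlaneSet →
      ∃ c₃ : ℝ≥0∞, c₃ ≠ ⊤ ∧ ∃ ε₀ : ℝ, 0 < ε₀ ∧ ∀ ε : ℝ, 0 < ε → ε ≤ ε₀ → ∀ x ∈ K, ∀ y ∈ K,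
        Process.preWienerMeasure {ω | infDist x (range (sleTrace κ ω)) ≤ ε ∧
            infDist y (range (sleTrace κ ω)) ≤ ε} ≤
          c₃ * ENNReal.ofReal (ε ^ (1 - (κ : ℝ) / 8)) ^ 2 * rieszKernel (1 - (κ : ℝ) / 8) x y)
    {κ : ℝ≥0} : ae_dimH_range_sleTrace (κ := κ) := by
  refine ae_dimH_range_sleTrace_of_root_facts_of_local_estimates h8 hne htr hd
    (fun {κ} hκ0 hκ8 ↦ ae_dimH_range_sleTrace_le_of_onePoint_upper' (hne hκ8.ne) fun K hK hKH ↦ ?_)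
    (fun {κ} hκ0 hκ8 K hK hKH ↦ ?_) hC
  · obtain ⟨c₁, c₂, -, hc₂, ε₀, hε₀, h⟩ := hP4 hκ0 hκ8 K hK hKH
    exact ⟨c₂, hc₂, ε₀, hε₀, fun ε hε hεε z hz ↦ (h ε hε hεε z hz).2⟩
  · obtain ⟨c₁, c₂, hc₁, -, ε₀, hε₀, h⟩ := hP4 hκ0 hκ8 K hK hKH
    exact ⟨c₁, hc₁, ε₀, hε₀, fun ε hε hεε z hz ↦ (h ε hε hεε z hz).1⟩

end Lower

end Literature.Probability.RandomPlanarGeometry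

end
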